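import Summits.ResolutionOfSingularities.ResolutionOfSingularities.Theorems.FrobeniusClosingSteerDescentSpacePersistence
import HarnessLib

/-!
# Cone rigidity (W4.1, F-B card 7 addendum g8 (R2)): a ternary form of degree `d` with a point of multiplicity `d`
# is a BINARY form in the two linear forms vanishing there

W4.1, crux `Steer` (stmt-ResolutionOfSingularities-16345), frontier piece F-B (hFBwild (Par-M) = K4); res-L0-w41-idea-1 g8's
`Sketch-idea-1-v10-cone.lean` 40317d2c766b8ef4 §PlaneLemma (card 7 `kangaroo-free-parity-automaton` addendum g8 §A.4 / §F (R0)–(R2);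
idea-1 11:17:06Z «free for any typer/prover»). The three definitions `dehom` / `shift` / `OrderGeAt` are VERBATIM from the sketch;
the stub `stub_binary_of_mult_eq_deg` is PROVED as `binary_of_mult_eq_deg` (seat res-D-pv-007 AS res-L0-w41-stub-5):

* `dehom κ Φ = Φ(1, Z, W)`, `shift κ z₀ w₀ φ = φ(Z + z₀, W + w₀)`, `OrderGeAt κ d z₀ w₀ φ` («order `≥ d` at `(z₀, w₀)`»);
* general kit: `isHomogeneous_aeval_of_forall` (substituting forms of degree `1` preserves forms),
  `totalDegree_aeval_le_of_forall` (substituting polynomials of degree `≤ 1` does not raise the total degree),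
  `rename_succ_dehom` (`dehom`, renamed into three variables, is the dehomogenisation `X 0 ↦ 1` of file 5);
* **`binary_of_mult_eq_deg`**: `Φ` a ternary form of degree `d`, `Φ(1, Z, W)` of order `≥ d` at the rational point `(z₀, w₀)`
  ⇒ `Φ = Ψ(X₁ − z₀X₀, X₂ − w₀X₀)` for a binary form `Ψ` of degree `d` (namely `Ψ = Φ(1, Z + z₀, W + w₀)`): the shifted
  dehomogenisation has degree `≤ d` and order `≥ d`, hence is a form, and two ternary forms of degree `d` with the same
  dehomogenisation coincide (`DescentSpace.eq_of_isHomogeneous_of_aeval_dehom_eq`, file 5 of the card-7 support).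

OURS (research support for an idea card; candidates, not facts); nothing here is a statement of the manuscript under review
[claim: Hironaka2017, status: under-review]; AI work, weaker than expert review. No instances, no new notation.
[cite: Hauser2010, §F] [folklore]
-/

noncomputable section

-- `Summit.<S>.<S>.…` duplicates the summit name by design (single-problem summit).
set_option linter.dupNamespace false

open MvPolynomial

namespace Summit.ResolutionOfSingularities.ResolutionOfSingularities.Theorems.SwitchingDichotomy.Cone

universe u v w

section Defs

variable (κ : Type u) [Field κ]

/-- Dehomogenisation `Φ(1, Z, W)` of a ternary form, as a polynomial in two variables. (res-L0-w41-idea-1 Sketch v10, verbatim.)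
OURS. [folklore] -/
def dehom (Φ : MvPolynomial (Fin 3) κ) : MvPolynomial (Fin 2) κ :=
  aeval (![1, X 0, X 1] : Fin 3 → MvPolynomial (Fin 2) κ) Φ

/-- Translation `φ(Z + z₀, W + w₀)`. (res-L0-w41-idea-1 Sketch v10, verbatim.) OURS. [folklore] -/
def shift (z₀ w₀ : κ) (φ : MvPolynomial (Fin 2) κ) : MvPolynomial (Fin 2) κ :=
  aeval (![X 0 + C z₀, X 1 + C w₀] : Fin 2 → MvPolynomial (Fin 2) κ) φ

/-- `φ` has order `≥ d` at the rational point `(z₀, w₀)`: every monomial of `φ(Z + z₀, W + w₀)` has total degree `≥ d`.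
(res-L0-w41-idea-1 Sketch v10, verbatim.) OURS. [folklore] -/
def OrderGeAt (d : ℕ) (z₀ w₀ : κ) (φ : MvPolynomial (Fin 2) κ) : Prop :=
  ∀ m ∈ (shift κ z₀ w₀ φ).support, d ≤ m 0 + m 1

end Defs

/-! ## General kit: substituting linear forms -/

section Kit

variable {κ : Type u} [Field κ] {σ : Type v} {τ : Type w}

/-- **Substituting forms of degree `1` preserves forms**: if every `g i` is homogeneous of degree `1` and `P` is homogeneous of
degree `n`, so is `aeval g P`. [folklore] -/
theorem isHomogeneous_aeval_of_forall (g : σ → MvPolynomial τ κ) (hg : ∀ i, (g i).IsHomogeneous 1)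
    {P : MvPolynomial σ κ} {n : ℕ} (hP : P.IsHomogeneous n) : (aeval g P).IsHomogeneous n := by
  classical
  rw [P.as_sum, map_sum]
  refine IsHomogeneous.sum _ _ _ fun m hm => ?_
  rw [aeval_monomial, MvPolynomial.algebraMap_eq, Finsupp.prod, hP.degree_eq_sum_deg_support hm]
  exact (IsHomogeneous.prod m.support (fun i => g i ^ m i) (fun i => m i) fun i _ => by
    simpa using (hg i).pow (m i)).C_mul _

/-- **Substituting polynomials of degree `≤ 1` does not raise the total degree.** [folklore] -/
theorem totalDegree_aeval_le_of_forall (g : σ → MvPolynomial τ κ) (hg : ∀ i, (g i).totalDegree ≤ 1)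
    (P : MvPolynomial σ κ) : (aeval g P).totalDegree ≤ P.totalDegree := by
  classical
  conv_lhs => rw [P.as_sum, map_sum]
  refine (totalDegree_finsetSum _ _).trans (Finset.sup_le fun m hm => ?_)
  rw [aeval_monomial, MvPolynomial.algebraMap_eq, Finsupp.prod]
  refine (totalDegree_mul _ _).trans ?_
  rw [totalDegree_C, zero_add]
  refine (totalDegree_finsetProd _ _).trans ?_
  refine le_trans (Finset.sum_le_sum fun i _ => (totalDegree_pow _ _).trans (Nat.mul_le_mul_left (m i) (hg i))) ?_
  simp only [mul_one]
  exact le_totalDegree hm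

/-- A polynomial of total degree `≤ n` all of whose monomials have degree `≥ n` is a form of degree `n`. [folklore] -/
theorem isHomogeneous_of_totalDegree_le_of_forall (P : MvPolynomial σ κ) (n : ℕ) (hle : P.totalDegree ≤ n)
    (hge : ∀ m ∈ P.support, n ≤ m.sum fun _ e => e) : P.IsHomogeneous n :=
  (DescentSpace.isHomogeneous_iff_forall_mem_support P n).mpr fun m hm =>
    le_antisymm ((le_totalDegree hm).trans hle) (hge m hm)

end Kit

/-! ## The plane lemma -/

section Plane

variable (κ : Type u) [Field κ]

/-- `dehom`, renamed into the variables `X 1, X 2` of the ternary ring, is the dehomogenisation `X 0 ↦ 1`. [folklore] -/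
theorem rename_succ_dehom (Φ : MvPolynomial (Fin 3) κ) :
    rename Fin.succ (dehom κ Φ) = aeval (fun i => if i = (0 : Fin 3) then (1 : MvPolynomial (Fin 3) κ) else X i) Φ := by
  unfold dehom
  rw [← AlgHom.comp_apply]
  congr 1
  refine MvPolynomial.algHom_ext fun i => ?_
  rw [AlgHom.comp_apply, aeval_X, aeval_X]
  fin_cases i
  · simp
  · simp
  · simp

/-- The monomials of a polynomial in two variables have degree `m 0 + m 1`. [folklore] -/
theorem sum_eq_add_fin_two (m : Fin 2 →₀ ℕ) : (m.sum fun _ e => e) = m 0 + m 1 := by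
  rw [Finsupp.sum_fintype _ _ (fun _ => rfl), Fin.sum_univ_two]

/-- **(R2) PROJECTIVE-PLANE LEMMA** (res-L0-w41-idea-1 Sketch v10 `stub_binary_of_mult_eq_deg`, PROVED): a ternary form `Φ`
of degree `d` whose plane curve has a point of multiplicity `d` at the rational point `[1 : z₀ : w₀]` (`Φ(1, Z, W)` of order
`≥ d` at `(z₀, w₀)`) is a binary form in the two linear forms vanishing there: `Φ = Ψ(X₁ − z₀X₀, X₂ − w₀X₀)` with `Ψ`
homogeneous of degree `d` — namely `Ψ = Φ(1, Z + z₀, W + w₀)`, a form because its degree is `≤ d` and its order `≥ d`;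
the identity holds because both sides are forms of degree `d` with the same dehomogenisation. [folklore] -/
theorem binary_of_mult_eq_deg (d : ℕ) (Φ : MvPolynomial (Fin 3) κ) (hΦ : Φ.IsHomogeneous d)
    (z₀ w₀ : κ) (hmult : OrderGeAt κ d z₀ w₀ (dehom κ Φ)) :
    ∃ Ψ : MvPolynomial (Fin 2) κ, Ψ.IsHomogeneous d ∧
      Φ = aeval (![X 1 - C z₀ * X 0, X 2 - C w₀ * X 0] : Fin 2 → MvPolynomial (Fin 3) κ) Ψ := by
  -- `Ψ := Φ(1, Z + z₀, W + w₀)` is a binary form of degree `d`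
  have hdeg : (shift κ z₀ w₀ (dehom κ Φ)).totalDegree ≤ d := by
    unfold shift dehom
    refine (totalDegree_aeval_le_of_forall _ (fun i => ?_) _).trans
      ((totalDegree_aeval_le_of_forall _ (fun i => ?_) _).trans hΦ.totalDegree_le)
    · fin_cases i
      · exact (totalDegree_add _ _).trans (max_le (totalDegree_X _).le (by rw [totalDegree_C]; exact zero_le_one))
      · exact (totalDegree_add _ _).trans (max_le (totalDegree_X _).le (by rw [totalDegree_C]; exact zero_le_one))
    · fin_cases i
      · exact (totalDegree_one (R := κ) (σ := Fin 2)).le.trans zero_le_one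
      · exact (totalDegree_X _).le
      · exact (totalDegree_X _).le
  have hΨ : (shift κ z₀ w₀ (dehom κ Φ)).IsHomogeneous d :=
    isHomogeneous_of_totalDegree_le_of_forall _ d hdeg fun m hm => by
      rw [sum_eq_add_fin_two]; exact hmult m hm
  refine ⟨shift κ z₀ w₀ (dehom κ Φ), hΨ, ?_⟩
  -- both sides are ternary forms of degree `d` …
  have hlin : ∀ i : Fin 2, ((![X 1 - C z₀ * X 0, X 2 - C w₀ * X 0] : Fin 2 → MvPolynomial (Fin 3) κ) i).IsHomogeneous 1 := by
    intro i
    fin_cases i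
    · exact (isHomogeneous_X κ 1).sub ((isHomogeneous_X κ 0).C_mul z₀)
    · exact (isHomogeneous_X κ 2).sub ((isHomogeneous_X κ 0).C_mul w₀)
  refine DescentSpace.eq_of_isHomogeneous_of_aeval_dehom_eq (0 : Fin 3) hΦ (isHomogeneous_aeval_of_forall _ hlin hΨ) ?_
  -- … with the same dehomogenisation `X 0 ↦ 1`
  have hcomp : ((aeval fun i => if i = (0 : Fin 3) then (1 : MvPolynomial (Fin 3) κ) else X i).comp
      ((aeval (![X 1 - C z₀ * X 0, X 2 - C w₀ * X 0] : Fin 2 → MvPolynomial (Fin 3) κ)).comp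
        ((aeval (![X 0 + C z₀, X 1 + C w₀] : Fin 2 → MvPolynomial (Fin 2) κ)).comp
          (aeval (![1, X 0, X 1] : Fin 3 → MvPolynomial (Fin 2) κ))))) =
      (rename Fin.succ).comp (aeval (![1, X 0, X 1] : Fin 3 → MvPolynomial (Fin 2) κ)) := by
    refine MvPolynomial.algHom_ext fun i => ?_
    fin_cases i <;> simp
  have happ := congrArg (fun f => f Φ) hcomp
  simp only [AlgHom.comp_apply] at happ
  rw [← rename_succ_dehom]
  unfold shift dehom
  exact happ.symm

end Plane

end Summit.ResolutionOfSingularities.ResolutionOfSingularities.Theorems.SwitchingDichotomy.Cone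

end
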